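import Summits.Parity.GeneralizedHardyLittlewood.Theorems.LiouvilleShiftedTablesSieveToMAvgSizeII

/-!
# Sieve glue for `SieveToMAvg`, part 12d: the sizes of the Type-I₂ majorant and of the sliver sum

Support file for item stmt-Parity-14274 (route `LiouvilleShiftedTables`).  At a dyadic scale
`x ∈ [Y/(2(log Y)^{13}), Y/2]` (`L = log Y`), with `Δ = L^{−A₁}`, `A = 2A₂`, `Kf = Kff A₁ Y`:

* `BI2 ≤ 36 √((4C'+1)C₂) Y/L^{A₂−(2A₁+4099)} + 768·2^e Cτ Y/L^{A₁−(e+1)} + Cτ (2L)^e 64 Y^{1−b'}(4L+2Q)`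
  (`BI2_le`; `C'` bounds the logarithmic divisor sum `Dτ'`);
* `SLIV ≤ 3 C_S C_φ Δ x L^{71}` (`SLIV_le`), from Shiu's theorem for `τ^{2j}` on the two slivers
  (`Literature.NumberTheory.Sieve.Shiu1980BrunTitchmarsh_holds.sigma_zero_pow`, taken as a hypothesis here)
  and `∑_{q ≤ Q} 1/φ(q) ≤ C_φ L⁴`.
-/

namespace Summit.Parity.GeneralizedHardyLittlewood.Theorems.SieveToMAvg

open Finset Real Filter
open scoped ArithmeticFunction.zeta ArithmeticFunction.sigma ArithmeticFunction.vonMangoldt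

/-! ### The Type-I₂ majorant -/

/-- With `A = 2A₂`: `√(C₂ Y / L^A) = √C₂ √Y / L^{A₂}` (`C₂ ≥ 0`, `L = log Y > 0`). [folklore] -/
theorem Psi_eq {Y C₂ : ℝ} (hC₂ : 0 ≤ C₂) (hL : 0 < Real.log Y) (A₂ : ℕ) :
    Real.sqrt (C₂ * Y / Real.log Y ^ (((2 * A₂ : ℕ) : ℝ))) = Real.sqrt C₂ * Real.sqrt Y / Real.log Y ^ A₂ := by
  rw [Real.rpow_natCast, pow_mul', Real.sqrt_div' _ (by positivity), Real.sqrt_sq (by positivity),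
    Real.sqrt_mul hC₂]

/-- **The size of `BI2`.** See the module docstring; hypotheses: `j ≤ 3`, `1 ≤ x`, `2x ≤ Y`,
`4 + log 64 ≤ L`, `L^{A₁} ≥ 2`, `1 ≤ Q ≤ Y`, `Cτ, C₂, C' ≥ 0`, `Dτ'(4j, 2x) ≤ C' L^{8192}`,
`Q · (2Cτ ℓ^e 2^{2j} (2x)^{1−b'}) ≤ Y L^{8194}`, `0 < 1 − b'`, `2A₁ + 4099 ≤ A₂`, `e + 1 ≤ A₁`. [folklore] -/
theorem BI2_le {j A₁ e A₂ Q : ℕ} (hj : j ≤ 3) {x Y Cτ C₂ C' b' : ℝ} (hx : 1 ≤ x) (hxY : 2 * x ≤ Y)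
    (hL : 4 + Real.log 64 ≤ Real.log Y) (hLA : 2 ≤ Real.log Y ^ A₁) (hQ1 : 1 ≤ Q) (hQY : (Q : ℝ) ≤ Y)
    (hCτ : 0 ≤ Cτ) (hC₂ : 0 ≤ C₂) (hC' : 0 ≤ C')
    (hD' : Dtau' (4 * j) (2 * x) ≤ C' * Real.log Y ^ 8192)
    (hgap : (Q : ℝ) * (2 * Cτ * ell2 j x ^ e * 2 ^ (2 * j) * (2 * x) ^ (1 - b')) ≤ Y * Real.log Y ^ 8194)
    (hb' : 0 < 1 - b') (hA₂ : 2 * A₁ + 4099 ≤ A₂) (hA₁ : e + 1 ≤ A₁) :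
    BI2 j x Y (Δf A₁ Y) (((2 * A₂ : ℕ) : ℝ)) C₂ Cτ b' e (Kff A₁ Y) Q ≤
      36 * Real.sqrt ((4 * C' + 1) * C₂) * Y / Real.log Y ^ (A₂ - (2 * A₁ + 4099)) +
      768 * 2 ^ e * Cτ * Y / Real.log Y ^ (A₁ - (e + 1)) +
      Cτ * (2 * Real.log Y) ^ e * 64 * Y ^ (1 - b') * (4 * Real.log Y + 2 * Q) := by
  set L := Real.log Y with hLdef
  have hl64 : 0 < Real.log 64 := Real.log_pos (by norm_num)
  have hL4 : 4 ≤ L := by linarith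
  have hL1 : 1 ≤ L := by linarith
  have hL0 : 0 < L := by linarith
  have hx0 : 0 < x := by linarith
  have hY1 : 1 ≤ Y := by linarith
  have hY0 : 0 ≤ Y := by linarith
  -- factors
  have hKf : (Kff A₁ Y : ℝ) ≤ 3 * L ^ (A₁ + 1) := Kff_le_three hY1 hL4 hLA
  have hKf1 : (1 : ℝ) ≤ Kff A₁ Y := by
    have : 1 ≤ Kff A₁ Y := by unfold Kff; omega
    exact_mod_cast this
  have hsqKf : Real.sqrt (Kff A₁ Y) ≤ (Kff A₁ Y : ℝ) := by
    calc Real.sqrt (Kff A₁ Y) ≤ Real.sqrt ((Kff A₁ Y : ℝ) ^ 2) := Real.sqrt_le_sqrt (by nlinarith)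
      _ = (Kff A₁ Y : ℝ) := Real.sqrt_sq (by positivity)
  have hKK : (Kff A₁ Y : ℝ) * Real.sqrt (Kff A₁ Y) ≤ 9 * L ^ (2 * A₁ + 2) := by
    calc (Kff A₁ Y : ℝ) * Real.sqrt (Kff A₁ Y) ≤ (3 * L ^ (A₁ + 1)) * (3 * L ^ (A₁ + 1)) :=
          mul_le_mul hKf (hsqKf.trans hKf) (Real.sqrt_nonneg _) (by positivity)
      _ = 9 * L ^ (2 * A₁ + 2) := by ring
  have hℓ : ell2 j x ≤ 2 * L := ell2_le hj hx0 hxY (by linarith)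
  have hℓ1 : 1 ≤ ell2 j x := one_le_ell2 j (by linarith)
  have hℓe : ell2 j x ^ e ≤ (2 * L) ^ e := pow_le_pow_left₀ (by linarith) hℓ e
  have h2j : (2 : ℝ) ^ (2 * j) ≤ 64 := by
    calc (2 : ℝ) ^ (2 * j) ≤ 2 ^ 6 := pow_le_pow_right₀ (by norm_num) (by omega)
      _ = 64 := by norm_num
  have hHQ : Hsum Q ≤ 2 * L := Hsum_le_two_log (t := (Q : ℝ)) (by exact_mod_cast hQ1) hQY hL1
  have hH2x : Hsum (2 * x) ≤ 2 * L := Hsum_le_two_log (by linarith) hxY hL1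
  have hHQ0 := Hsum_nonneg (Q : ℝ)
  have hH2x0 := Hsum_nonneg (2 * x)
  have hD'0 := Dtau'_nonneg (4 * j) (2 * x)
  -- the square root
  have hinner : 2 * x * Hsum Q * Hsum (2 * x) * Dtau' (4 * j) (2 * x) +
      Q * (2 * Cτ * ell2 j x ^ e * 2 ^ (2 * j) * (2 * x) ^ (1 - b')) ≤ (4 * C' + 1) * Y * L ^ 8194 := by
    have h1 : 2 * x * Hsum Q * Hsum (2 * x) * Dtau' (4 * j) (2 * x) ≤ Y * (2 * L) * (2 * L) * (C' * L ^ 8192) :=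
      mul_le_mul (mul_le_mul (mul_le_mul hxY hHQ hHQ0 hY0) hH2x hH2x0 (by positivity)) hD' hD'0 (by positivity)
    have : Y * (2 * L) * (2 * L) * (C' * L ^ 8192) = 4 * C' * Y * L ^ 8194 := by ring
    rw [this] at h1
    linarith
  have hsq : Real.sqrt (2 * x * Hsum Q * Hsum (2 * x) * Dtau' (4 * j) (2 * x) +
      Q * (2 * Cτ * ell2 j x ^ e * 2 ^ (2 * j) * (2 * x) ^ (1 - b'))) ≤
      Real.sqrt (4 * C' + 1) * Real.sqrt Y * L ^ 4097 := by
    refine (Real.sqrt_le_sqrt hinner).trans (le_of_eq ?_)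
    rw [Real.sqrt_mul (by positivity), Real.sqrt_mul (by positivity), show (8194 : ℕ) = 2 * 4097 from rfl,
      pow_mul', Real.sqrt_sq (by positivity)]
  have hΨ : Real.sqrt (C₂ * Y / Real.log Y ^ (((2 * A₂ : ℕ) : ℝ))) = Real.sqrt C₂ * Real.sqrt Y / L ^ A₂ :=
    Psi_eq hC₂ hL0 A₂
  -- Term 1
  have hT1 : 4 * (Kff A₁ Y : ℝ) * Real.sqrt (Kff A₁ Y) *
      Real.sqrt (2 * x * Hsum Q * Hsum (2 * x) * Dtau' (4 * j) (2 * x) +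
        Q * (2 * Cτ * ell2 j x ^ e * 2 ^ (2 * j) * (2 * x) ^ (1 - b'))) *
      Real.sqrt (C₂ * Y / Real.log Y ^ (((2 * A₂ : ℕ) : ℝ))) ≤
      36 * Real.sqrt ((4 * C' + 1) * C₂) * Y / L ^ (A₂ - (2 * A₁ + 4099)) := by
    rw [hΨ]
    calc 4 * (Kff A₁ Y : ℝ) * Real.sqrt (Kff A₁ Y) *
          Real.sqrt (2 * x * Hsum Q * Hsum (2 * x) * Dtau' (4 * j) (2 * x) +
            Q * (2 * Cτ * ell2 j x ^ e * 2 ^ (2 * j) * (2 * x) ^ (1 - b'))) *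
          (Real.sqrt C₂ * Real.sqrt Y / L ^ A₂)
        = 4 * ((Kff A₁ Y : ℝ) * Real.sqrt (Kff A₁ Y)) *
          Real.sqrt (2 * x * Hsum Q * Hsum (2 * x) * Dtau' (4 * j) (2 * x) +
            Q * (2 * Cτ * ell2 j x ^ e * 2 ^ (2 * j) * (2 * x) ^ (1 - b'))) *
          (Real.sqrt C₂ * Real.sqrt Y / L ^ A₂) := by ring
      _ ≤ 4 * (9 * L ^ (2 * A₁ + 2)) * (Real.sqrt (4 * C' + 1) * Real.sqrt Y * L ^ 4097) *
          (Real.sqrt C₂ * Real.sqrt Y / L ^ A₂) := by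
          have := Real.sqrt_nonneg (Kff A₁ Y : ℝ)
          gcongr
      _ = 36 * (Real.sqrt (4 * C' + 1) * Real.sqrt C₂) * (Real.sqrt Y * Real.sqrt Y) *
          (L ^ (2 * A₁ + 2 + 4097) / L ^ A₂) := by rw [pow_add]; ring
      _ = 36 * Real.sqrt ((4 * C' + 1) * C₂) * Y / L ^ (A₂ - (2 * A₁ + 4099)) := by
          rw [← Real.sqrt_mul (by positivity), Real.mul_self_sqrt hY0, show 2 * A₁ + 2 + 4097 = 2 * A₁ + 4099 by ring,
            pow_div_pow_eq_inv hL0.ne' hA₂, div_eq_mul_inv]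
  -- Term 2
  have hT2 : 12 * Δf A₁ Y * Hsum Q * Cτ * ell2 j x ^ e * 2 ^ (2 * j) * x ≤ 768 * 2 ^ e * Cτ * Y / L ^ (A₁ - (e + 1)) := by
    have hΔ : Δf A₁ Y = (L ^ A₁)⁻¹ := rfl
    have hxY' : x ≤ Y / 2 := by linarith
    calc 12 * Δf A₁ Y * Hsum Q * Cτ * ell2 j x ^ e * 2 ^ (2 * j) * x
        ≤ 12 * (L ^ A₁)⁻¹ * (2 * L) * Cτ * (2 * L) ^ e * 64 * (Y / 2) := by
          rw [hΔ]
          have : 0 ≤ (L ^ A₁)⁻¹ := by positivity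
          have : 0 ≤ ell2 j x ^ e := by positivity
          gcongr
      _ = 768 * 2 ^ e * Cτ * Y * (L ^ (e + 1) / L ^ A₁) := by rw [mul_pow, pow_succ]; ring
      _ = 768 * 2 ^ e * Cτ * Y / L ^ (A₁ - (e + 1)) := by
          rw [pow_div_pow_eq_inv hL0.ne' hA₁, div_eq_mul_inv]
  -- Term 3
  have hT3 : Cτ * ell2 j x ^ e * 2 ^ (2 * j) * (2 * x) ^ (1 - b') * (2 * Hsum Q + 2 * Q) ≤
      Cτ * (2 * L) ^ e * 64 * Y ^ (1 - b') * (4 * L + 2 * Q) := by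
    have hp : (2 * x) ^ (1 - b') ≤ Y ^ (1 - b') := Real.rpow_le_rpow (by linarith) hxY hb'.le
    have : 0 ≤ (2 * x) ^ (1 - b') := Real.rpow_nonneg (by linarith) _
    have : 0 ≤ ell2 j x ^ e := by positivity
    have : 2 * Hsum Q + 2 * Q ≤ 4 * L + 2 * Q := by linarith
    gcongr
  unfold BI2
  linarith [hT1, hT2, hT3]

/-! ### The sliver sum -/

/-- **The size of `SLIV`** through Shiu's theorem for `τ^{2j}` (hypothesis `hSh`, the shape of
`Shiu1980BrunTitchmarsh.sigma_zero_pow (2j)` with `ε = θ = 1/4`, constant `C_S`, threshold `x₀`) and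
`∑_{q ≤ Q} 1/φ(q) ≤ C_φ L⁴`: if `x₀ ≤ x`, `1 ≤ x`, `2x ≤ Y`, `1 ≤ L = log Y`, `0 < Δ ≤ 1`,
`x^{1/4} ≤ Δx`, `(2x)^{1/4} ≤ Δx`, `Q < (Δx)^{3/4}`, then `SLIV ≤ 3 C_S C_φ Δ x L^{71}`. [folklore] -/
theorem SLIV_le {j h Q : ℕ} (hj : j ≤ 3) {x Y Δ C_S C_φ x₀ : ℝ} (hCS : 0 ≤ C_S)
    (hSh : ∀ x y : ℝ, x₀ ≤ x → 1 ≤ x → 0 ≤ y → x ^ ((1 : ℝ) / 4) ≤ y → y ≤ x → ∀ q : ℕ, 1 ≤ q →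
      (q : ℝ) < y ^ ((1 : ℝ) - 1 / 4) → ∀ a : ℕ, a.Coprime q →
        ∑ n ∈ (Icc 1 ⌊x + y⌋₊).filter (fun n : ℕ => x < n ∧ (n : ZMod q) = (a : ZMod q)), (σ 0 n : ℝ) ^ (2 * j) ≤
          C_S * y / (Nat.totient q : ℝ) * Real.log x ^ (2 ^ (2 * j) - 1))
    (hφ : ∑ q ∈ Icc 1 Q, ((Nat.totient q : ℝ))⁻¹ ≤ C_φ * Real.log Y ^ 4)
    (hx₀ : x₀ ≤ x) (hx : 1 ≤ x) (hxY : 2 * x ≤ Y) (hL : 1 ≤ Real.log Y) (hΔ : 0 < Δ) (hΔ1 : Δ ≤ 1)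
    (hy1 : x ^ ((1 : ℝ) / 4) ≤ Δ * x) (hy2 : (2 * x) ^ ((1 : ℝ) / 4) ≤ Δ * x) (hQ : (Q : ℝ) < (Δ * x) ^ ((1 : ℝ) - 1 / 4)) :
    SLIV j h Q x Δ ≤ 3 * C_S * C_φ * Δ * x * Real.log Y ^ 71 := by
  classical
  set L := Real.log Y with hLdef
  have hx0 : 0 < x := by linarith
  have hΔx : 0 < Δ * x := mul_pos hΔ hx0
  -- the two slivers
  set x₂ : ℝ := 2 * x / (1 + Δ) with hx₂
  set y₂ : ℝ := 2 * x - x₂ with hy₂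
  have h1Δ : 0 < 1 + Δ := by linarith
  have hx₂x : x ≤ x₂ := by rw [hx₂, le_div_iff₀ h1Δ]; nlinarith
  have hx₂le : x₂ ≤ 2 * x := by rw [hx₂, div_le_iff₀ h1Δ]; nlinarith
  have hy₂eq : y₂ = 2 * x * Δ / (1 + Δ) := by rw [hy₂, hx₂]; field_simp; ring
  have hy₂lo : Δ * x ≤ y₂ := by rw [hy₂eq, le_div_iff₀ h1Δ]; nlinarith
  have hy₂hi : y₂ ≤ 2 * (Δ * x) := by rw [hy₂eq, div_le_iff₀ h1Δ]; nlinarith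
  have hy₂x₂ : y₂ ≤ x₂ := by
    rw [hy₂eq, hx₂, div_le_div_iff_of_pos_right h1Δ]; nlinarith
  have hsum : x₂ + y₂ = 2 * x := by rw [hy₂]; ring
  -- logarithms
  have hlogx : 0 ≤ Real.log x := Real.log_nonneg hx
  have hlogxL : Real.log x ≤ L := Real.log_le_log hx0 (by linarith)
  have hlogx₂ : 0 ≤ Real.log x₂ := Real.log_nonneg (hx.trans hx₂x)
  have hlogx₂L : Real.log x₂ ≤ L := Real.log_le_log (by linarith) (hx₂le.trans hxY)
  have hpowlog : ∀ t : ℝ, 0 ≤ t → t ≤ L → t ^ (2 ^ (2 * j) - 1) ≤ L ^ 67 := by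
    intro t ht htL
    calc t ^ (2 ^ (2 * j) - 1) ≤ L ^ (2 ^ (2 * j) - 1) := pow_le_pow_left₀ ht htL _
      _ ≤ L ^ 67 := by
          refine pow_le_pow_right₀ hL ?_
          have : 2 ^ (2 * j) ≤ 2 ^ 6 := Nat.pow_le_pow_right (by norm_num) (by omega)
          omega
  -- per modulus
  have hper : ∀ q ∈ moduli Q h,
      ∑ n ∈ (dyadClass h q x).filter (fun n => Sliver x Δ n), (σ 0 n : ℝ) ^ (2 * j) ≤
        3 * C_S * Δ * x * L ^ 67 * ((Nat.totient q : ℝ))⁻¹ := by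
    intro q hq
    obtain ⟨⟨hq1, hqQ⟩, hqh⟩ := mem_moduli.1 hq
    have hqlt1 : (q : ℝ) < (Δ * x) ^ ((1 : ℝ) - 1 / 4) := lt_of_le_of_lt (by exact_mod_cast hqQ) hQ
    have hqlt2 : (q : ℝ) < y₂ ^ ((1 : ℝ) - 1 / 4) :=
      hqlt1.trans_le (Real.rpow_le_rpow hΔx.le hy₂lo (by norm_num))
    -- Shiu on the two ranges
    have hS1 := hSh x (Δ * x) hx₀ hx hΔx.le hy1 (by nlinarith) q hq1 hqlt1 h hqh.symm
    have hS2 := hSh x₂ y₂ (hx₀.trans hx₂x) (hx.trans hx₂x) (hΔx.le.trans hy₂lo)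
      ((Real.rpow_le_rpow (by linarith) hx₂le (by norm_num)).trans (hy2.trans hy₂lo))
      hy₂x₂ q hq1 hqlt2 h hqh.symm
    rw [hsum] at hS2
    have hφ0 : (0 : ℝ) < Nat.totient q := by exact_mod_cast Nat.totient_pos.2 hq1
    -- split the sliver set
    set T := (dyadClass h q x).filter (fun n => Sliver x Δ n) with hT
    rw [← Finset.sum_filter_add_sum_filter_not T (fun n : ℕ => (n : ℝ) ≤ (1 + Δ) * x)]
    have hsub1 : T.filter (fun n : ℕ => (n : ℝ) ≤ (1 + Δ) * x) ⊆
        (Icc 1 ⌊x + Δ * x⌋₊).filter (fun n : ℕ => x < n ∧ (n : ZMod q) = (h : ZMod q)) := by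
      intro n hn
      simp only [hT, Finset.mem_filter, mem_dyadClass] at hn
      obtain ⟨⟨⟨⟨hn1, hn2⟩, hmod⟩, -⟩, hle⟩ := hn
      rw [Finset.mem_filter, Finset.mem_Icc]
      refine ⟨⟨by omega, Nat.le_floor (by linarith)⟩, (Nat.floor_lt hx0.le).1 hn1, (ZMod.natCast_eq_natCast_iff _ _ _).2 hmod⟩
    have hsub2 : T.filter (fun n : ℕ => ¬ (n : ℝ) ≤ (1 + Δ) * x) ⊆
        (Icc 1 ⌊2 * x⌋₊).filter (fun n : ℕ => x₂ < n ∧ (n : ZMod q) = (h : ZMod q)) := by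
      intro n hn
      simp only [hT, Finset.mem_filter, mem_dyadClass] at hn
      obtain ⟨⟨⟨⟨hn1, hn2⟩, hmod⟩, hsl⟩, hle⟩ := hn
      rw [Finset.mem_filter, Finset.mem_Icc]
      refine ⟨⟨by omega, hn2⟩, ?_, (ZMod.natCast_eq_natCast_iff _ _ _).2 hmod⟩
      unfold Sliver at hsl
      rcases hsl with h1 | h2
      · exact absurd h1 hle
      · exact h2
    have hnn : ∀ n : ℕ, 0 ≤ (σ 0 n : ℝ) ^ (2 * j) := fun n => by positivity
    have hb1 := (Finset.sum_le_sum_of_subset_of_nonneg hsub1 fun n _ _ => hnn n).trans hS1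
    have hb2 := (Finset.sum_le_sum_of_subset_of_nonneg hsub2 fun n _ _ => hnn n).trans hS2
    -- numeric bounds
    have hc1 : C_S * (Δ * x) / (Nat.totient q : ℝ) * Real.log x ^ (2 ^ (2 * j) - 1) ≤
        C_S * (Δ * x) * L ^ 67 * ((Nat.totient q : ℝ))⁻¹ := by
      rw [div_eq_mul_inv]
      have := hpowlog _ hlogx hlogxL
      have : 0 ≤ C_S * (Δ * x) * ((Nat.totient q : ℝ))⁻¹ := by positivity
      nlinarith
    have hc2 : C_S * y₂ / (Nat.totient q : ℝ) * Real.log x₂ ^ (2 ^ (2 * j) - 1) ≤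
        C_S * (2 * (Δ * x)) * L ^ 67 * ((Nat.totient q : ℝ))⁻¹ := by
      rw [div_eq_mul_inv]
      have h67 := hpowlog _ hlogx₂ hlogx₂L
      have hy₂0 : 0 ≤ y₂ := hΔx.le.trans hy₂lo
      calc C_S * y₂ * ((Nat.totient q : ℝ))⁻¹ * Real.log x₂ ^ (2 ^ (2 * j) - 1)
          ≤ C_S * (2 * (Δ * x)) * ((Nat.totient q : ℝ))⁻¹ * L ^ 67 := by
            refine mul_le_mul (mul_le_mul_of_nonneg_right (mul_le_mul_of_nonneg_left hy₂hi hCS) (by positivity))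
              h67 (by positivity) (by positivity)
        _ = _ := by ring
    linarith [hb1, hb2, hc1, hc2]
  unfold SLIV
  calc ∑ q ∈ moduli Q h, ∑ n ∈ (dyadClass h q x).filter (fun n => Sliver x Δ n), (σ 0 n : ℝ) ^ (2 * j)
      ≤ ∑ q ∈ moduli Q h, 3 * C_S * Δ * x * L ^ 67 * ((Nat.totient q : ℝ))⁻¹ := Finset.sum_le_sum hper
    _ = 3 * C_S * Δ * x * L ^ 67 * ∑ q ∈ moduli Q h, ((Nat.totient q : ℝ))⁻¹ := by rw [Finset.mul_sum]
    _ ≤ 3 * C_S * Δ * x * L ^ 67 * (C_φ * L ^ 4) := by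
        refine mul_le_mul_of_nonneg_left ?_ (by positivity)
        exact (Finset.sum_le_sum_of_subset_of_nonneg (Finset.filter_subset _ _) fun q _ _ => by positivity).trans hφ
    _ = 3 * C_S * C_φ * Δ * x * Real.log Y ^ 71 := by rw [hLdef]; ring

end Summit.Parity.GeneralizedHardyLittlewood.Theorems.SieveToMAvg
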